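/-
Copyright (c) 2026 the pub-hodgecm-mathlib formalisation cell (harness21).  Prover seat hodgecm-mathlib-K2E5-p23 (g0),
Track B «K2-LIT» ∕ h413, ENGINE E5 «TamagawaUnitary», unit NORM-THEOREMS, socket `sig_K2E5NormFujisaki` (:97).  2026-09-03.
-/
import Literature.NumberTheory.Automorphic.MatrixAdeleModule                     -- ★ `distribHaarChar_matrix_adele_eq_adelicAbsDet_pow` (Δ(X ↦ gX) = |det g|ⁿ), `distribHaarChar_pi_units`, `adelicAbsDet_apply`; transitively ★ `QuaternionAlgebraAdelicFujisaki` (`exists_isCompact_mul_inclAdelic_mem`, `rightModule_eq_leftModule_of_isUnit`)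
import Literature.NumberTheory.Automorphic.AdicCompletionCompact                 -- ★ `locallyCompactSpace_adeleRing'`
import Literature.NumberTheory.Automorphic.AdelicSecondCountable                 -- ★ `secondCountableTopology_adeleRing`
import HarnessLib

/-!
# K2 ∕ E5 «TamagawaUnitary», unit NORM-THEOREMS — FILE `K2E5NormFujisaki`: FUJISAKI'S LEMMA (Vignéras III Thm. 1.4 (3); Weil BNT IV §3 Thm. 4)
# for a quaternion division algebra over a number field (socket `NormTheorems.sig_K2E5NormFujisaki` BY NAME)

Cell `hodgecm-mathlib` (Track B «K2-LIT»), floor 0, item h413 = `stmt-HodgeConjecture-24833`; tier-0 line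
`Cruxes/H413/Lines/K2_E5_TamagawaUnitary.lean` (ED. 2), tier-1 socket module `Cruxes/H413/Lines/K2_E5_TamagawaUnitary_NormTheorems.lean`
(K2E5-plan (g0), sha16 481d3f8cb02c670a), socket `…Cruxes.H413.K2E5TamagawaUnitary.NormTheorems.sig_K2E5NormFujisaki` (:97, size L; the
compactness input of the CORE stub `stub_suCovolInvariance` (S3) and of unit DET-SECTION `sig_K2E5DetSUCocompact`).  PROOF lane (theorems only,
no definition, no named fact, no instance); author K2E5-p23 (g0).  Per the cell protocol the Lines module is NOT imported: the TYPE of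
`normFujisaki` below is the socket's statement token for token, and the by-name fold
`theorem sig_K2E5NormFujisaki : … := K2E5NormFujisaki.normFujisaki` goes into the socket module at its next edition (kernel certificate of the
token identity at home: `K2/K2E5-p23/g0/Probe_K2E5NormFujisaki.lean`, `example : type_of% @… = type_of% @… := rfl`).

Content (Vignéras LNM 800, Ch. III §1, Thm. fondamental 1.4, Idèles 3) «(Fujisaki [1]) … pour tout corps (de quaternions) X, X_{A,1}/X_K^• est
compact», with `X_{A,1} = {x ∈ X_A^• | ‖N(x)‖_A = 1}`, `N(x) = det(y ↦ x y)` the algebra norm; Weil, *Basic Number Theory*, Ch. IV §3 Thm. 4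
(p. 74, «the proof is due to Fujisaki»)).  For a number field `K` and a quaternion DIVISION algebra `D` over `K` there is a COMPACT subset
`C ⊆ D_𝔸ˣ = (𝔸_K ⊗_K D)ˣ` such that every adelic unit `x` of MODULE ONE — `‖N(x)‖_𝔸 = 1`, where `N(x) = det_{𝔸_K}(y ↦ x y) ∈ 𝔸_Kˣ` and
`‖·‖_𝔸 = IdeleClassGroup.ideleNorm K` is the idelic module — factors as `x = c · γ` with `c ∈ C` and `γ ∈ Dˣ` diagonally embedded
(`inclAdelic`): `X_{𝔸,1} ⊆ C · Dˣ`.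

PROOF STRATEGY (tree reuse first — nothing is restated).  The tree PROVES Fujisaki's lemma in WEIL'S form for every finite-dimensional
division algebra over `K` (★ `Literature.NumberTheory.Automorphic.exists_isCompact_mul_inclAdelic_mem`, `QuaternionAlgebraAdelicProofs`,
kernel-checked; its classical inputs — discreteness and cocompactness of `D ⊆ D_𝔸` (★ `discreteTopology_rationalLattice_holds`,
★ `compactSpace_quotient_rationalLattice_holds`), local compactness of `𝔸_K` (★ `locallyCompactSpace_adeleRing'`) — are all discharged):
for `m > 0` a compact `Y ⊆ D_𝔸ˣ` with `x · Dˣ ∩ Y ≠ ∅` for every `x` with LEFT module `‖x‖ₗ ≤ m` and RIGHT module `‖x‖ᵣ ≥ m⁻¹`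
(`‖·‖ₗ`, `‖·‖ᵣ` = Mathlib `distribHaarChar` of `y ↦ x y`, `y ↦ y x` on the additive group `D_𝔸`; ★ `leftModule`, ★ `rightModule`), and
★ `rightModule_eq_leftModule_of_isUnit` (`QuaternionAlgebraAdelicFujisaki`, Vignéras II §4 «module commun», for division algebras, with the
archimedean module formula ★ `addHaar_posRealCentral_smul_holds`) gives `‖x‖ᵣ = ‖x‖ₗ`.  So with `m = 1` the socket follows from ONE new
brick, the dictionary between the socket's currency and Weil's:

* §1 **`leftModule_eq_ideleNorm_norm`** — for every finite-dimensional `D ≠ 0` over `K` and every `u ∈ D_𝔸ˣ`,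
  `‖u‖ₗ = ‖N_{D_𝔸/𝔸_K}(u)‖_𝔸` (Weil IV §3 Prop. 3 Cor.: «the module of `x ↦ u x` is `|N(u)|_A`»; Vignéras II §4 Lemme 4.4 / III §1).
  Proof: with `N = dim_K D` and the base-changed basis `β` of `D_𝔸` over `𝔸_K` (the one of ★ `ScalarExtension.coordLinearEquiv`), the
  COLUMN isomorphism `e : D_𝔸ᴺ ≅ M_N(𝔸_K)`, `e(a)_{i j} = β.repr (a j) i`, is bi-continuous additive and intertwines coordinatewise left
  multiplication by `u` with left multiplication by the matrix `ℓ(u) = leftMulMatrix β u ∈ GL_N(𝔸_K)` (Mathlib `Algebra.leftMulMatrix_mulVec_repr`);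
  hence `‖u‖ₗᴺ = Δ_{D_𝔸ᴺ}((u)_j)` (★ `distribHaarChar_pi_units`) `= Δ_{M_N(𝔸_K)}(ℓ(u))` (★ `distribHaarChar_eq_of_continuousAddEquiv`) `= |det ℓ(u)|_𝔸ᴺ`
  (★ `distribHaarChar_matrix_adele_eq_adelicAbsDet_pow`, Weil IV §3 Prop. 3), so `‖u‖ₗ = |det ℓ(u)|_𝔸 = ‖N(u)‖_𝔸` (Mathlib
  `Algebra.norm_eq_matrix_det`: `N(u) = det ℓ(u)`).
* §2 **`normFujisaki`** — THE SOCKET: `C := Y` (`m = 1`); for `‖N(x)‖_𝔸 = 1`, §1 gives `‖x‖ₗ = 1 = ‖x‖ᵣ`, so `x · δ ∈ Y` for some `δ ∈ Dˣ`,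
  i.e. `x = (x δ) · δ⁻¹` with `x δ ∈ C`, `γ = δ⁻¹`.  The socket's `N` is `LinearMap.det ∘ Algebra.lmul`, which IS Mathlib's `Algebra.norm`
  (`Algebra.norm_apply`, definitional).

HONEST LABEL: HC_CM is proved only modulo the 7 printed citations (2 remaining named inputs: hLiu418 = stmt-HodgeConjecture-24832,
h413 = stmt-HodgeConjecture-24833) until rung 0 closes; this file closes ONE size-L socket of ONE tier-1 unit and discharges none of them.

AUDIT (materialised pages; corpus key `book:vignerasnd-arithmetique-des-algebres-de-quaternions` = V80): p0055.txt:L5 «THEOREME FONDAMENTAL 1.4.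
Adèles. 1) X_K est discret dans X_A et X_A/X_K est compact.» + p0056.txt:L3 «(Fujisaki) … compact»; Weil BNT Ch. IV §3 Thm. 4 p. 74.

## References
* [VignerasLNM800] M.-F. Vignéras, *Arithmétique des algèbres de quaternions*, LNM 800, Springer 1980 — Ch. III §1 Thm. 1.4 (Idèles 3, lemme de
  Fujisaki), Ch. II §4 (module, Lemme 4.4).
* [WeilBNT1967] A. Weil, *Basic Number Theory*, Grundlehren 144, Springer 1967 — Ch. IV §3 Prop. 3 and Cor., Thm. 4 (Fujisaki); Ch. IV §4 (module of an idele).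
* [Voight2021] J. Voight, *Quaternion algebras*, GTM 288, Springer 2021 — Main Thm. 27.6.14.
-/

set_option autoImplicit false
set_option linter.dupNamespace false

noncomputable section

namespace Summit.HodgeConjecture.HodgeConjecture.Cruxes.H413.K2E5NormFujisaki

open NumberField IsDedekindDomain MeasureTheory
open scoped NNReal MatrixGroups
open Literature.NumberTheory.Automorphic

universe u

/-! ## §1 The left module of an adelic unit is the idelic module of its algebra norm (Weil IV §3 Prop. 3 Cor.) -/

/-- **`‖u‖ₗ = ‖N_{D_𝔸/𝔸_K}(u)‖_𝔸`.**  For a number field `K`, a finite-dimensional `K`-algebra `D ≠ 0` and a unit `u` of `D_𝔸 = 𝔸_K ⊗_K D`,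
the module of the automorphism `y ↦ u y` of the additive group `D_𝔸` (★ `leftModule`, Mathlib `distribHaarChar`) is the idelic module
(`IdeleClassGroup.ideleNorm`) of the algebra norm `N(u) = det_{𝔸_K}(y ↦ u y) ∈ 𝔸_Kˣ` (Mathlib `Algebra.norm`).  Weil, BNT IV §3, Cor. of
Prop. 3: «the module of the automorphism `x → ax` of `𝒜_A` is `|N(a)|_A`»; Vignéras II §4 Lemme 4.4, III §1.  Proof: the column isomorphism
`D_𝔸ᴺ ≅ M_N(𝔸_K)` attached to an `𝔸_K`-basis turns coordinatewise left multiplication by `u` into `X ↦ ℓ(u) X`, `ℓ(u)` the matrix of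
`y ↦ u y`, whose module is `|det ℓ(u)|_𝔸ᴺ` (★ `distribHaarChar_matrix_adele_eq_adelicAbsDet_pow`), while the diagonal unit `(u)_j` of the
product ring `D_𝔸ᴺ` has module `‖u‖ₗᴺ` (★ `distribHaarChar_pi_units`) and `det ℓ(u) = N(u)` (Mathlib `Algebra.norm_eq_matrix_det`).
[cite: WeilBNT1967, Ch. IV §3 Prop. 3 and Cor. (p. 73)] [cite: VignerasLNM800, Ch. II §4 Lemme 4.4; Ch. III §1 (‖·‖_A)] -/
theorem leftModule_eq_ideleNorm_norm (K : Type) [Field K] [NumberField K] (D : Type u) [Ring D] [Algebra K D]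
    [Module.Finite K D] [Nontrivial D] [LocallyCompactSpace (AdeleRing (𝓞 K) K)]
    (u : (ScalarExtension K (AdeleRing (𝓞 K) K) D)ˣ) :
    leftModule K D u =
      IdeleClassGroup.ideleNorm K
        (Units.map (Algebra.norm (AdeleRing (𝓞 K) K) (S := ScalarExtension K (AdeleRing (𝓞 K) K) D)) u) := by
  classical
  haveI : T2Space (AdeleRing (𝓞 K) K) := t2Space_adeleRing K
  haveI : SecondCountableTopology (AdeleRing (𝓞 K) K) := secondCountableTopology_adeleRing K
  haveI : SecondCountableTopology (ScalarExtension K (AdeleRing (𝓞 K) K) D) :=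
    (ScalarExtension.coordHomeomorph K (AdeleRing (𝓞 K) K) D).secondCountableTopology
  haveI : LocallyCompactSpace
      (Matrix (Fin (Module.finrank K D)) (Fin (Module.finrank K D)) (AdeleRing (𝓞 K) K)) :=
    inferInstanceAs
      (LocallyCompactSpace (Fin (Module.finrank K D) → Fin (Module.finrank K D) → AdeleRing (𝓞 K) K))
  -- the base-changed basis `β` of `D_𝔸` over `𝔸_K` (the one behind ★ `ScalarExtension.coordLinearEquiv`) and the matrix `ℓ(u)` of `y ↦ u y`
  let β : Module.Basis (Fin (Module.finrank K D)) (AdeleRing (𝓞 K) K) (ScalarExtension K (AdeleRing (𝓞 K) K) D) :=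
    Algebra.TensorProduct.basis (AdeleRing (𝓞 K) K) (Module.finBasis K D)
  let ℓ : ScalarExtension K (AdeleRing (𝓞 K) K) D →ₐ[AdeleRing (𝓞 K) K]
      Matrix (Fin (Module.finrank K D)) (Fin (Module.finrank K D)) (AdeleRing (𝓞 K) K) :=
    Algebra.leftMulMatrix β
  let g : GL (Fin (Module.finrank K D)) (AdeleRing (𝓞 K) K) :=
    Units.map (ℓ : ScalarExtension K (AdeleRing (𝓞 K) K) D →*
      Matrix (Fin (Module.finrank K D)) (Fin (Module.finrank K D)) (AdeleRing (𝓞 K) K)) u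
  -- the column isomorphism `e : D_𝔸ᴺ ≅ M_N(𝔸_K)`, `e(a)_{i j} = β.repr (a j) i`
  let e : (Fin (Module.finrank K D) → ScalarExtension K (AdeleRing (𝓞 K) K) D) ≃ₜ+
      Matrix (Fin (Module.finrank K D)) (Fin (Module.finrank K D)) (AdeleRing (𝓞 K) K) :=
    { toFun := fun a => Matrix.of fun i j => ScalarExtension.coordHomeomorph K (AdeleRing (𝓞 K) K) D (a j) i
      invFun := fun M j => (ScalarExtension.coordHomeomorph K (AdeleRing (𝓞 K) K) D).symm fun i => M i j
      left_inv := fun a => funext fun j => by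
        simp only [Matrix.of_apply]
        exact (ScalarExtension.coordHomeomorph K (AdeleRing (𝓞 K) K) D).symm_apply_apply (a j)
      right_inv := fun M => by
        ext i j
        simp only [Matrix.of_apply, Homeomorph.apply_symm_apply]
      map_add' := fun a b => by
        ext i j
        simp only [Matrix.of_apply, Pi.add_apply, Matrix.add_apply, ScalarExtension.coordHomeomorph_apply, map_add]
      continuous_toFun := continuous_matrix fun i j =>
        (continuous_apply i).comp
          ((ScalarExtension.coordHomeomorph K (AdeleRing (𝓞 K) K) D).continuous.comp (continuous_apply j))
      continuous_invFun := continuous_pi fun j =>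
        (ScalarExtension.coordHomeomorph K (AdeleRing (𝓞 K) K) D).symm.continuous.comp
          (continuous_pi fun i => continuous_apply_apply i j) }
  -- the diagonal unit `U = (u)_j` of the product ring `D_𝔸ᴺ`: `U • a = (u · a_j)_j`
  let U : (Fin (Module.finrank K D) → ScalarExtension K (AdeleRing (𝓞 K) K) D)ˣ :=
    ⟨fun _ => (u : ScalarExtension K (AdeleRing (𝓞 K) K) D),
      fun _ => ((u⁻¹ : (ScalarExtension K (AdeleRing (𝓞 K) K) D)ˣ) : ScalarExtension K (AdeleRing (𝓞 K) K) D),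
      funext fun _ => u.mul_inv, funext fun _ => u.inv_mul⟩
  have hU : ∀ j, MulEquiv.piUnits U j = u := fun j => Units.ext rfl
  -- equivariance: `e (U • a) = ℓ(u) • e a` (Mathlib `Algebra.leftMulMatrix_mulVec_repr`)
  have he : ∀ a : Fin (Module.finrank K D) → ScalarExtension K (AdeleRing (𝓞 K) K) D, e (U • a) = g • e a := by
    intro a
    ext i j
    change β.repr ((u : ScalarExtension K (AdeleRing (𝓞 K) K) D) * a j) i =
      (Algebra.leftMulMatrix β (u : ScalarExtension K (AdeleRing (𝓞 K) K) D) *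
        Matrix.of fun i j => β.repr (a j) i) i j
    rw [← Algebra.leftMulMatrix_mulVec_repr β, Matrix.mul_apply]
    simp only [Matrix.mulVec, dotProduct, Matrix.of_apply]
  -- `‖u‖ₗᴺ = Δ_{D_𝔸ᴺ}(U) = Δ_{M_N(𝔸_K)}(ℓ u) = |det ℓ(u)|_𝔸ᴺ`
  have hN : Module.finrank K D ≠ 0 := Module.finrank_pos.ne'
  have h1 : distribHaarChar (Fin (Module.finrank K D) → ScalarExtension K (AdeleRing (𝓞 K) K) D) U =
      leftModule K D u ^ Module.finrank K D := by
    rw [distribHaarChar_pi_units U]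
    simp only [hU, Finset.prod_const, Finset.card_univ, Fintype.card_fin]
    rfl
  have h2 : distribHaarChar (Fin (Module.finrank K D) → ScalarExtension K (AdeleRing (𝓞 K) K) D) U =
      adelicAbsDet (Module.finrank K D) K g ^ Module.finrank K D := by
    rw [distribHaarChar_eq_of_continuousAddEquiv e U g he, distribHaarChar_matrix_adele_eq_adelicAbsDet_pow]
  have h3 : leftModule K D u = adelicAbsDet (Module.finrank K D) K g := by
    apply pow_left_injective hN
    dsimp only
    rw [← h1, h2]
  -- `|det ℓ(u)|_𝔸 = ‖N(u)‖_𝔸`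
  rw [h3, adelicAbsDet_apply]
  congr 1
  ext
  rw [Matrix.GeneralLinearGroup.val_det_apply, Units.coe_map, Units.coe_map, MonoidHom.coe_coe,
    Algebra.norm_eq_matrix_det β]

/-! ## §2 The socket: Fujisaki's lemma for the module-one adelic units of a quaternion division algebra -/

/-- **FILE `K2E5NormFujisaki` — socket `NormTheorems.sig_K2E5NormFujisaki` proved, statement token for token.**  FUJISAKI'S LEMMA
(Vignéras III Thm. 1.4 (3); Weil BNT IV §3 Thm. 4): for a quaternion DIVISION algebra `D` over a number field `K`, the adelic units of MODULE
ONE `X_{𝔸,1} = {x ∈ (𝔸_K ⊗_K D)ˣ | ‖N(x)‖_𝔸 = 1}` (`N(x) = det_{𝔸_K}(y ↦ x y) = Nrd(x)²`, `‖·‖_𝔸 = IdeleClassGroup.ideleNorm`) have a COMPACT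
fundamental set modulo `Dˣ`: a compact `C ⊆ (𝔸_K ⊗_K D)ˣ` with `X_{𝔸,1} ⊆ C · Dˣ`.  Assembly of ★ `exists_isCompact_mul_inclAdelic_mem`
(Weil's two-sided form, `m = 1`), ★ `rightModule_eq_leftModule_of_isUnit` (`‖x‖ᵣ = ‖x‖ₗ`) and §1 (`‖x‖ₗ = ‖N(x)‖_𝔸`); the division
hypothesis enters through `Dˣ = D ∖ 0` (`Ne.isUnit`).
[cite: VignerasLNM800, Ch. III §1 Thm. 1.4 (Théorème fondamental: Idèles 3, lemme de Fujisaki), pp. 55–56] [cite: WeilBNT1967, Ch. IV §3 Thm. 4 (p. 74); Ch. IV §4 (module of an idele)] [cite: Voight2021, Main Thm. 27.6.14] -/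
theorem normFujisaki :
    ∀ (K : Type) [Field K] [NumberField K] (D : Type) [DivisionRing D] [Algebra K D] [IsQuaternionAlgebra K D],
      ∃ C : Set (adelicUnits K D), IsCompact C ∧
        ∀ x : adelicUnits K D,
          IdeleClassGroup.ideleNorm K
              (Units.map
                ((LinearMap.det :
                      Module.End (AdeleRing (𝓞 K) K) (ScalarExtension K (AdeleRing (𝓞 K) K) D) →* AdeleRing (𝓞 K) K).comp
                  ((Algebra.lmul (AdeleRing (𝓞 K) K) (ScalarExtension K (AdeleRing (𝓞 K) K) D) :
                      ScalarExtension K (AdeleRing (𝓞 K) K) D →ₐ[AdeleRing (𝓞 K) K]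
                        Module.End (AdeleRing (𝓞 K) K) (ScalarExtension K (AdeleRing (𝓞 K) K) D)) :
                      ScalarExtension K (AdeleRing (𝓞 K) K) D →* Module.End (AdeleRing (𝓞 K) K) (ScalarExtension K (AdeleRing (𝓞 K) K) D)))
                x) = 1 →
            ∃ (γ : Dˣ) (c : adelicUnits K D), c ∈ C ∧ x = c * inclAdelic K D γ := by
  intro K _ _ D _ _ _
  haveI : LocallyCompactSpace (AdeleRing (𝓞 K) K) := locallyCompactSpace_adeleRing' K
  have hdiv : ∀ d : D, d ≠ 0 → IsUnit d := fun d hd => hd.isUnit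
  have hdisc : DiscreteTopology (rationalLattice K D) := discreteTopology_rationalLattice_holds K D
  have hcpt : CompactSpace (ScalarExtension K (AdeleRing (𝓞 K) K) D ⧸ rationalLattice K D) :=
    compactSpace_quotient_rationalLattice_holds K D
  -- Weil's two-sided Fujisaki lemma with `m = 1`
  obtain ⟨Y, hYc, hY⟩ := exists_isCompact_mul_inclAdelic_mem K D hdiv hdisc hcpt 1 one_ne_zero
  refine ⟨Y, hYc, fun x hx => ?_⟩
  -- `‖x‖ₗ = ‖N(x)‖_𝔸 = 1` (§1) and `‖x‖ᵣ = ‖x‖ₗ` (module commun)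
  have hl : leftModule K D x = 1 := by
    rw [leftModule_eq_ideleNorm_norm]
    exact hx
  have hr : rightModule K D x = 1 := by
    rw [rightModule_eq_leftModule_of_isUnit K D hdiv hdisc hcpt (addHaar_posRealCentral_smul_holds K D) x, hl]
  obtain ⟨δ, hδ⟩ := hY x hl.le (by rw [inv_one, hr])
  exact ⟨δ⁻¹, x * inclAdelic K D δ, hδ, by rw [map_inv, mul_inv_cancel_right]⟩

end Summit.HodgeConjecture.HodgeConjecture.Cruxes.H413.K2E5NormFujisaki

end
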